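import Summits.CriticalPhenomena.CardyFormulaZ2.Theorems.CardyIKTransportIKLinearTransportStubExchangeChain

/-!
# Sub-goal `exchangeChain_transparency` (line `pinned-diagram-exchange`, crux stmt-CriticalPhenomena-5076)

TRANSPARENCY (the finite evaporation identity) of the composed column-exchange chain. The chain
`stub_ExchangeChain` (landed; here its conclusion is taken as the HYPOTHESIS) gives, for every finite
admissible schedule `(S t, i t)_{t<n}`, one map `Tc : Obs → Rnd → Obs` transporting `ν_{S 0} ⊗ β` to
`ν_{S n}` which almost surely leaves unchanged the colours off the swept cell columns `i t + 1`, the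
diagonal flags off the swept face columns `i t, i t + 1` and the monochromatic-cluster membership of any
two cells off the swept cell columns. COROLLARY: every measurable event `E` of observables which is
invariant under changes of the swept data (`x ∈ E ↔ y ∈ E` whenever `x, y` agree on the unswept colours,
the unswept diagonals and the connectivity among unswept cells) has the same probability under
`ν_{S 0}` and `ν_{S n}`.

Proof: `ν_{S n} E = (ν_{S 0} ⊗ β) (Tc ⁻¹' E)` (law transport), `Tc ⁻¹' E = fst ⁻¹' E` almost surely
(the almost-sure clause fed into the invariance of `E`), and `(ν_{S 0} ⊗ β) (fst ⁻¹' E) = ν_{S 0} E`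
(`β` is a probability measure).
-/

noncomputable section

namespace Summit.CriticalPhenomena.CardyFormulaZ2.Theorems.IKLinearTransport.PinnedDiagramExchange

open scoped BigOperators Topology Classical MeasureTheory ProbabilityTheory ENNReal symmDiff
open Filter Set Function MeasureTheory
open Literature.Probability.Percolation Literature.Probability.LatticeModels
open Literature.Probability.RandomPlanarGeometry

/-- TRANSPARENCY of the exchange chain (finite evaporation identity): given the composed exchange maps
of `stub_ExchangeChain` (hypothesis), every measurable event of observables invariant under changes of
the colours on the swept cell columns `i t + 1`, of the diagonal flags on the swept face columns
`i t, i t + 1` and of anything but the monochromatic-cluster membership among unswept cells has the same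
probability under `ν_{S 0}` and `ν_{S n}`, for every finite admissible schedule `(S t, i t)_{t<n}`.
[folklore] -/
theorem exchangeChain_transparency :
    (∀ (n : ℕ) (S : ℕ → Set ℤ) (i : ℕ → ℤ),
      (∀ t : ℕ, t < n → (i t ∈ S t ↔ i t + 1 ∉ S t) ∧ S (t + 1) = S t ∆ {i t, i t + 1}) →
      ∃ Tc : Obs → Rnd → Obs, Measurable (Function.uncurry Tc) ∧
        ((νmix (S 0)).prod β).map (Function.uncurry Tc) = νmix (S n) ∧
        (∀ᵐ xu ∂((νmix (S 0)).prod β),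
          (∀ v : Site 2, (∀ t : ℕ, t < n → v 0 ≠ i t + 1) → (v ∈ (Tc xu.1 xu.2).1 ↔ v ∈ xu.1.1)) ∧
          (∀ f : Site 2, (∀ t : ℕ, t < n → f 0 ≠ i t ∧ f 0 ≠ i t + 1) →
            (f ∈ (Tc xu.1 xu.2).2 ↔ f ∈ xu.1.2)) ∧
          (∀ a b : Site 2, (∀ t : ℕ, t < n → a 0 ≠ i t + 1) → (∀ t : ℕ, t < n → b 0 ≠ i t + 1) →
            (b ∈ monoCluster (Tc xu.1 xu.2) a ↔ b ∈ monoCluster xu.1 a))) ∧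
        (∀ (m : ℤ) (x : Obs) (u : Rnd), Tc (vshift m x) (ushift m u) = vshift m (Tc x u))) →
    ∀ (n : ℕ) (S : ℕ → Set ℤ) (i : ℕ → ℤ),
      (∀ t : ℕ, t < n → (i t ∈ S t ↔ i t + 1 ∉ S t) ∧ S (t + 1) = S t ∆ {i t, i t + 1}) →
      ∀ E : Set Obs, MeasurableSet E →
        (∀ x y : Obs,
          (∀ v : Site 2, (∀ t : ℕ, t < n → v 0 ≠ i t + 1) → (v ∈ x.1 ↔ v ∈ y.1)) →
          (∀ f : Site 2, (∀ t : ℕ, t < n → f 0 ≠ i t ∧ f 0 ≠ i t + 1) → (f ∈ x.2 ↔ f ∈ y.2)) →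
          (∀ a b : Site 2, (∀ t : ℕ, t < n → a 0 ≠ i t + 1) → (∀ t : ℕ, t < n → b 0 ≠ i t + 1) →
            (b ∈ monoCluster x a ↔ b ∈ monoCluster y a)) →
          (x ∈ E ↔ y ∈ E)) →
        νmix (S 0) E = νmix (S n) E := by
  intro hchain n S i hS E hE hinv
  obtain ⟨Tc, hTm, hlaw, hae, -⟩ := hchain n S i hS
  haveI : IsProbabilityMeasure β := by unfold β; infer_instance
  haveI := ExchangeChain.sFinite_nuMix (S 0)
  -- law transport: `ν_{S n} E = (ν_{S 0} ⊗ β) (Tc ⁻¹' E)`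
  rw [← hlaw, Measure.map_apply hTm hE]
  -- first marginal: `ν_{S 0} E = (ν_{S 0} ⊗ β) (fst ⁻¹' E)`
  have hfst : ((νmix (S 0)).prod β) (Prod.fst ⁻¹' E) = νmix (S 0) E := by
    rw [← Measure.map_apply measurable_fst hE, Measure.map_fst_prod, measure_univ, one_smul]
  rw [← hfst]
  -- the two preimages agree almost surely, by the almost-sure clause and the invariance of `E`
  refine measure_congr ?_
  filter_upwards [hae] with xu hxu
  obtain ⟨hc, hf, hm⟩ := hxu
  change (xu.1 ∈ E) = (Tc xu.1 xu.2 ∈ E)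
  exact propext (hinv (Tc xu.1 xu.2) xu.1 hc hf hm).symm

end Summit.CriticalPhenomena.CardyFormulaZ2.Theorems.IKLinearTransport.PinnedDiagramExchange

end
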